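import Mathlib
import HarnessLib
import Summits.Ventures.LatticeQCDFlow.Scoring.RestartChainJarzynskiDeltaF
import Summits.Ventures.LatticeQCDFlow.Scoring.CPNMetropolisSweepBatchMeans
import Summits.Ventures.LatticeQCDFlow.Scoring.HeatBathSweepAutocorrelation

/-!
# S0-D2 AS RUN: the `cpn_2d` Metropolis sweep is a legal PRIOR CHAIN of the correlated-restart
# Jarzynski protocol — it is minorised in one step by the lattice CP(N−1) law itself — so the
# studentised `ΔF̂ = −log Ḡ` along the restart chain it drives is asymptotically standard normal
# from every start, with asymptotically exact coverage of `ΔF̂ ± z σ̂/(Ḡ√N)`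

HONEST FRAMING: exact (Metropolis-corrected) sampling algorithms for lattice gauge theory;
figures of merit are autocorrelation/cost numbers at stated couplings and volumes; no
continuum-physics claim.

Venture `LatticeQCDFlow` (cell pub-lqcd), topic `Scoring`; FANOUT row 8 (`s0-cpn-nemc` — the 2D
CP(N−1) NE-MCMC seat; Bonanno–Nada–Vadacchino 2024 NAMED ONLY — GEN-25).  NEW WORK of the cell, not a
published result; no definition is introduced; nothing is cited as a fact.

THE OBJECTS.  Row 9's `cpn_2d` Metropolis sweep `cpnMetropolisSweep src tgt J c εs εl l` on CP(N−1)
configurations `CPNConfig V E d` (sites `V`, links `E`, per-link couplings `c : E → ℝ` — an open /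
defect boundary is a choice of `c`), exact for the lattice CP(N−1) law `cpnGibbsLaw src tgt J c`
and minorised IN ONE STEP by the uniform product law (`Scoring/CPNMetropolisSweepBatchMeans.lean`:
`cpn_metropolisSweep_minorised`, GEN-19); GEN-22's error bar of the correlated-restart Jarzynski
estimator (`Scoring/RestartChainJarzynskiDeltaF.lean`): for a Crooks pair `(κF, κR, s, e, W)` from
`ν₀` to `ν₁`, a prior chain `κ₀` leaving `π₀ = Z₀⁻¹ ν₀` invariant WITH `κ₀(x, ·) ≥ ε π₀` (`ε > 0`), a
work floor and `σ²_G > 0`, the studentised `−log Ḡ_N` along the restart chain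
`K = prodMkRight E κ₀ ⊗ₖ prodMkLeft (Ω × E) κF` is asymptotically `N(0, 1)` from every initial law.
The prior-side hypothesis there is a minorisation BY `π₀`; the `cpn_2d` certificate minorises by the
UNIFORM law.  This file closes that gap and reads off the protocol's error bar for the `cpn_2d` prior:

* **`cpn_metropolisSweep_minorised_by_cpnGibbsLaw`** — `εs, εl > 0`, the scan list visits every
  variable: `cpnGibbsLaw` is invariant AND there is `ε ∈ (0, 1)` with
  `ε · cpnGibbsLaw(A) ≤ K(ω, A)` for every configuration `ω` and measurable `A` (the uniform law
  dominates `Z M⁻¹ · cpnGibbsLaw`, `M` the maximum of the continuous Gibbs density on the compact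
  configuration space: `Scoring/HeatBathSweepAutocorrelation.pi_ge_piGibbsLaw`);
* **`cpn_restart_jarzynski_deltaF_studentized_clt`** — for ANY Crooks pair `(κF, κR, s, e, W)` on a
  path space `P` from a finite measure `ν₀` with `Z₀⁻¹ ν₀ = cpnGibbsLaw src tgt J c` (the prior
  ensemble, e.g. the open-boundary / defect CP(N−1) weight) to a finite measure `ν₁` (the target
  weight), with a work floor, `e^{−ΔF} = Z₁/Z₀` and `σ²_G > 0` (ASSUMED), the restart chain driven by
  the `cpn_2d` sweep satisfies, for `Y ~ N(0, 1)`, any `a_n, b_n → ∞` and EVERY initial law `μ₀`: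
  `√N_n (−log Ḡ_{N_n} − ΔF) / (|−Ḡ⁻¹| √(σ̂²_n)) ⇒ Y`;
* **`cpn_restart_jarzynski_deltaF_coverage`** — for every `z > 0`,
  `P_{μ₀} {|√N_n (−log Ḡ − ΔF)| / (|−Ḡ⁻¹| √(σ̂²_n)) ≤ z} → (gaussianReal 0 1)[−z, z]`.

READING: with the `cpn_2d` Metropolis sweep as the equilibrium prior (at the prior couplings `c`),
NO further hypothesis on the prior side is needed for the S0-D2 error bar `ΔF̂ ± z σ̂_n/(Ḡ √N)` to be
asymptotically exact from a cold or hot start; what remains assumed is on the non-equilibrium side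
(a genuine Crooks pair between the two weights, a work floor — automatic for bounded actions — and a
non-degenerate weight sequence).

NOT CLAIMED: any value of `ε`, `σ²_G` or of the bar for a concrete `(N, β, L, n_step)`; the
construction of the CP(N−1) non-equilibrium evolution as a Crooks pair (taken as a hypothesis, as in
every restart-chain file); the heat-bath / over-relaxation prior (same argument with
`Scoring/CPNHeatBathSweepBatchMeans.lean`, not typed here); the degenerate case `σ²_G = 0`; any number
of ours.
-/

noncomputable section

namespace Summit.Ventures.LatticeQCDFlow.Scoring

open MeasureTheory ProbabilityTheory Filter Finset Preorder Set
open Summit.Ventures.LatticeQCDFlow.Exactness Summit.Ventures.LatticeQCDFlow.Exactness.GeneralNCMC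
open Literature.Probability.MarkovChains
open scoped ENNReal Topology

section CPN

variable {V E : Type*} [Fintype V] [Fintype E] [DecidableEq V] [DecidableEq E] {d : ℕ}
  (src tgt : E → V) (J : EuclideanSpace ℝ (Fin (d + 2)) →L[ℝ] EuclideanSpace ℝ (Fin (d + 2)))
  (c : E → ℝ)

/-- **THE `cpn_2d` METROPOLIS SWEEP IS MINORISED BY THE LATTICE CP(N−1) LAW ITSELF, IN ONE STEP**
(`εs, εl > 0`, the list visits every variable): `cpnGibbsLaw` is invariant and there is `ε ∈ (0, 1)`
with `ε · cpnGibbsLaw(A) ≤ K(ω, A)` for every configuration `ω` and measurable `A`. -/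
theorem cpn_metropolisSweep_minorised_by_cpnGibbsLaw {εs εl : ℝ} (hεs : 0 < εs) (hεl : 0 < εl)
    {l : List (V ⊕ E)} (hl : ∀ i, i ∈ l) :
    Kernel.Invariant (cpnMetropolisSweep src tgt J c εs εl l) (cpnGibbsLaw src tgt J c) ∧
    ∃ ε : ℝ≥0∞, 0 < ε ∧ ε < 1 ∧ ∀ (ω : CPNConfig V E d) {A : Set (CPNConfig V E d)},
      MeasurableSet A →
        ε * cpnGibbsLaw src tgt J c A ≤ cpnMetropolisSweep src tgt J c εs εl l ω A := by
  obtain ⟨hinv, ε, hε0, hε1, hdoeb⟩ := cpn_metropolisSweep_minorised src tgt J c hεs hεl hl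
  refine ⟨hinv, ?_⟩
  have hS := continuous_cpnAction src tgt J c (V := V) (E := E) (d := d)
  haveI : ∀ i, Nonempty (CPNVar V E d i) := fun i =>
    nonempty_of_isProbabilityMeasure (cpnRef V E d i)
  haveI : Nonempty (CPNConfig V E d) := inferInstance
  obtain ⟨ωa, -, hmin⟩ := isCompact_univ.exists_isMinOn Set.univ_nonempty hS.continuousOn
  obtain ⟨ωb, -, hmax⟩ := isCompact_univ.exists_isMaxOn Set.univ_nonempty hS.continuousOn
  have hωa : ∀ ω, cpnAction src tgt J c ωa ≤ cpnAction src tgt J c ω := fun ω =>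
    (isMinOn_iff.1 hmin) ω (Set.mem_univ ω)
  have hωb : ∀ ω, cpnAction src tgt J c ω ≤ cpnAction src tgt J c ωb := fun ω =>
    (isMaxOn_iff.1 hmax) ω (Set.mem_univ ω)
  -- the Gibbs density is pinched between two positive constants
  have hm0 : ENNReal.ofReal (Real.exp (-cpnAction src tgt J c ωb)) ≠ 0 := by
    rw [Ne, ENNReal.ofReal_eq_zero, not_le]; exact Real.exp_pos _
  have hMtop : ENNReal.ofReal (Real.exp (-cpnAction src tgt J c ωa)) ≠ ∞ := ENNReal.ofReal_ne_top
  have hM0 : ENNReal.ofReal (Real.exp (-cpnAction src tgt J c ωa)) ≠ 0 := by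
    rw [Ne, ENNReal.ofReal_eq_zero, not_le]; exact Real.exp_pos _
  have hmp : ∀ ω, ENNReal.ofReal (Real.exp (-cpnAction src tgt J c ωb))
      ≤ gibbsDensity (cpnAction src tgt J c) ω := fun ω =>
    ENNReal.ofReal_le_ofReal (Real.exp_le_exp.2 (neg_le_neg (hωb ω)))
  have hpM : ∀ ω, gibbsDensity (cpnAction src tgt J c) ω
      ≤ ENNReal.ofReal (Real.exp (-cpnAction src tgt J c ωa)) := fun ω =>
    ENNReal.ofReal_le_ofReal (Real.exp_le_exp.2 (neg_le_neg (hωa ω)))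
  -- `Z M⁻¹ ∈ (0, 1]`
  have hZlow : ENNReal.ofReal (Real.exp (-cpnAction src tgt J c ωb))
      ≤ ∫⁻ ω, gibbsDensity (cpnAction src tgt J c) ω ∂Measure.pi (cpnRef V E d) := by
    calc ENNReal.ofReal (Real.exp (-cpnAction src tgt J c ωb))
        = ∫⁻ _, ENNReal.ofReal (Real.exp (-cpnAction src tgt J c ωb)) ∂Measure.pi (cpnRef V E d) := by
          rw [lintegral_const, measure_univ, mul_one]
      _ ≤ _ := lintegral_mono fun ω => hmp ω
  have hZup : ∫⁻ ω, gibbsDensity (cpnAction src tgt J c) ω ∂Measure.pi (cpnRef V E d)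
      ≤ ENNReal.ofReal (Real.exp (-cpnAction src tgt J c ωa)) := by
    calc ∫⁻ ω, gibbsDensity (cpnAction src tgt J c) ω ∂Measure.pi (cpnRef V E d)
        ≤ ∫⁻ _, ENNReal.ofReal (Real.exp (-cpnAction src tgt J c ωa)) ∂Measure.pi (cpnRef V E d) :=
          lintegral_mono fun ω => hpM ω
      _ = _ := by rw [lintegral_const, measure_univ, mul_one]
  have hq1 : (∫⁻ ω, gibbsDensity (cpnAction src tgt J c) ω ∂Measure.pi (cpnRef V E d))
      * (ENNReal.ofReal (Real.exp (-cpnAction src tgt J c ωa)))⁻¹ ≤ 1 := by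
    calc (∫⁻ ω, gibbsDensity (cpnAction src tgt J c) ω ∂Measure.pi (cpnRef V E d))
          * (ENNReal.ofReal (Real.exp (-cpnAction src tgt J c ωa)))⁻¹
        ≤ ENNReal.ofReal (Real.exp (-cpnAction src tgt J c ωa))
          * (ENNReal.ofReal (Real.exp (-cpnAction src tgt J c ωa)))⁻¹ := mul_le_mul' hZup le_rfl
      _ = 1 := ENNReal.mul_inv_cancel hM0 hMtop
  have hq0 : (∫⁻ ω, gibbsDensity (cpnAction src tgt J c) ω ∂Measure.pi (cpnRef V E d))
      * (ENNReal.ofReal (Real.exp (-cpnAction src tgt J c ωa)))⁻¹ ≠ 0 :=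
    mul_ne_zero (lt_of_lt_of_le (pos_iff_ne_zero.2 hm0) hZlow).ne' (ENNReal.inv_ne_zero.2 hMtop)
  refine ⟨ε * ((∫⁻ ω, gibbsDensity (cpnAction src tgt J c) ω ∂Measure.pi (cpnRef V E d))
      * (ENNReal.ofReal (Real.exp (-cpnAction src tgt J c ωa)))⁻¹),
    pos_iff_ne_zero.2 (mul_ne_zero hε0.ne' hq0),
    lt_of_le_of_lt (mul_le_of_le_one_right hε0.le hq1) hε1, fun ω A hA => ?_⟩
  calc ε * ((∫⁻ ω, gibbsDensity (cpnAction src tgt J c) ω ∂Measure.pi (cpnRef V E d))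
        * (ENNReal.ofReal (Real.exp (-cpnAction src tgt J c ωa)))⁻¹) * cpnGibbsLaw src tgt J c A
      = ε * ((∫⁻ ω, gibbsDensity (cpnAction src tgt J c) ω ∂Measure.pi (cpnRef V E d))
          * (ENNReal.ofReal (Real.exp (-cpnAction src tgt J c ωa)))⁻¹
          * piGibbsLaw (cpnRef V E d) (gibbsDensity (cpnAction src tgt J c)) A) := by
        rw [mul_assoc]; rfl
    _ ≤ ε * Measure.pi (cpnRef V E d) A :=
        mul_le_mul' le_rfl (pi_ge_piGibbsLaw (μ := cpnRef V E d)
          (p := gibbsDensity (cpnAction src tgt J c)) hm0 hMtop hmp hpM hA)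
    _ ≤ cpnMetropolisSweep src tgt J c εs εl l ω A := hdoeb ω hA

variable {P : Type*} [MeasurableSpace P]
  {ν₀ ν₁ : Measure (CPNConfig V E d)} {κF κR : Kernel (CPNConfig V E d) P}
  [IsMarkovKernel κF] [IsMarkovKernel κR] {s e : P → CPNConfig V E d} {W : P → ℝ}

/-- **THE S0-D2 ERROR BAR WITH THE `cpn_2d` PRIOR, FROM ANY START.**  `εs, εl > 0`, the scan visits
every variable; a Crooks pair `(κF, κR, s, e, W)` from `ν₀` (with `Z₀⁻¹ ν₀ = cpnGibbsLaw`) to `ν₁`,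
work floor `W ≥ W_lo`, `e^{−ΔF} = Z₁/Z₀`, `σ²_G > 0`, `a_n, b_n → ∞`, `N_n = b_n a_n`; for
`Y ~ N(0, 1)` and EVERY initial law `μ₀` of the restart chain driven by the `cpn_2d` Metropolis
sweep: `√N_n (−log Ḡ_{N_n} − ΔF) / (|−Ḡ⁻¹| √(σ̂²_n)) ⇒ Y`. -/
theorem cpn_restart_jarzynski_deltaF_studentized_clt {εs εl : ℝ} (hεs : 0 < εs) (hεl : 0 < εl)
    {l : List (V ⊕ E)} (hl : ∀ i, i ∈ l) (h : CrooksPair ν₀ ν₁ κF κR s e W)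
    (hπ₀ : cpnGibbsLaw src tgt J c = (ν₀ univ)⁻¹ • ν₀)
    {Wlo : ℝ} (hlo : ∀ ω, Wlo ≤ W ω)
    {ΔF : ℝ} (hΔF : Real.exp (-ΔF) = ((ν₀ univ)⁻¹ * ν₁ univ).toReal)
    (hσ : 0 < ((∫ p, (Real.exp (-W p.2) - ∫ p', Real.exp (-W p'.2)
            ∂(cpnGibbsLaw src tgt J c ⊗ₘ κF)) ^ 2 ∂(cpnGibbsLaw src tgt J c ⊗ₘ κF))
          + 2 * ∑' k, ∫ p, (Real.exp (-W p.2) - ∫ p', Real.exp (-W p'.2)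
            ∂(cpnGibbsLaw src tgt J c ⊗ₘ κF))
            * (kop ((Kernel.prodMkRight P (cpnMetropolisSweep src tgt J c εs εl l))
                ⊗ₖ (Kernel.prodMkLeft (CPNConfig V E d × P) κF)))^[k + 1]
              (fun p => Real.exp (-W p.2) - ∫ p', Real.exp (-W p'.2)
                ∂(cpnGibbsLaw src tgt J c ⊗ₘ κF)) p ∂(cpnGibbsLaw src tgt J c ⊗ₘ κF)))
    (μ₀ : Measure (CPNConfig V E d × P)) [IsProbabilityMeasure μ₀] {a b : ℕ → ℕ}
    (ha : Tendsto a atTop atTop) (hb : Tendsto b atTop atTop)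
    {Ω' : Type*} [MeasurableSpace Ω'] {P' : Measure Ω'} [IsProbabilityMeasure P'] {Y : Ω' → ℝ}
    (hY : HasLaw Y (gaussianReal 0 1) P')
    [hK : IsMarkovKernel (cpnMetropolisSweep src tgt J c εs εl l)]
    [IsProbabilityMeasure (Kernel.trajMeasure (X := fun _ : ℕ => CPNConfig V E d × P) μ₀
          (fun n : ℕ => ((Kernel.prodMkRight P (cpnMetropolisSweep src tgt J c εs εl l))
              ⊗ₖ (Kernel.prodMkLeft (CPNConfig V E d × P) κF)).comap
            (fun h : (i : ↥(Finset.Iic n)) → CPNConfig V E d × P => h ⟨n, Finset.mem_Iic.2 le_rfl⟩)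
            (measurable_pi_apply _)))] :
    TendstoInDistribution (fun (n : ℕ) (x : ℕ → CPNConfig V E d × P) =>
        Real.sqrt ((b n * a n : ℕ) : ℝ)
          * (-Real.log ((∑ t ∈ Finset.range (b n * a n), Real.exp (-W (x t).2))
            / ((b n * a n : ℕ) : ℝ)) - ΔF)
          / (|(-((∑ t ∈ Finset.range (b n * a n), Real.exp (-W (x t).2)) / ((b n * a n : ℕ) : ℝ))⁻¹)|
            * Real.sqrt (((b n * a n : ℕ) : ℝ) * replicaSEsq (fun j (x : ℕ → CPNConfig V E d × P) =>
              (∑ i ∈ Finset.range (b n), Real.exp (-W (x (b n * j + i)).2)) / (b n)) (a n) x)))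
      atTop Y (fun _ => (Kernel.trajMeasure (X := fun _ : ℕ => CPNConfig V E d × P) μ₀
          (fun n : ℕ => ((Kernel.prodMkRight P (cpnMetropolisSweep src tgt J c εs εl l))
              ⊗ₖ (Kernel.prodMkLeft (CPNConfig V E d × P) κF)).comap
            (fun h : (i : ↥(Finset.Iic n)) → CPNConfig V E d × P => h ⟨n, Finset.mem_Iic.2 le_rfl⟩)
            (measurable_pi_apply _)))) P' := by
  haveI := isProbabilityMeasure_cpnGibbsLaw src tgt J c (V := V) (E := E) (d := d)
  obtain ⟨hinv, ε, hε0, -, hdoeb⟩ :=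
    cpn_metropolisSweep_minorised_by_cpnGibbsLaw src tgt J c hεs hεl hl
  exact restart_jarzynski_deltaF_studentized_clt (π₀ := cpnGibbsLaw src tgt J c)
    (κ₀ := cpnMetropolisSweep src tgt J c εs εl l) h hπ₀ hinv (fun x _ hB => hdoeb x hB) hε0 hlo
    hΔF hσ μ₀ ha hb hY

/-- **ASYMPTOTICALLY EXACT COVERAGE OF THE S0-D2 INTERVAL WITH THE `cpn_2d` PRIOR.**  Under the
hypotheses of `cpn_restart_jarzynski_deltaF_studentized_clt`, for every `z > 0`:
`P_{μ₀} {|√N_n (−log Ḡ − ΔF)| / (|−Ḡ⁻¹| √(σ̂²_n)) ≤ z} → (gaussianReal 0 1)[−z, z]`. -/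
theorem cpn_restart_jarzynski_deltaF_coverage {εs εl : ℝ} (hεs : 0 < εs) (hεl : 0 < εl)
    {l : List (V ⊕ E)} (hl : ∀ i, i ∈ l) (h : CrooksPair ν₀ ν₁ κF κR s e W)
    (hπ₀ : cpnGibbsLaw src tgt J c = (ν₀ univ)⁻¹ • ν₀)
    {Wlo : ℝ} (hlo : ∀ ω, Wlo ≤ W ω)
    {ΔF : ℝ} (hΔF : Real.exp (-ΔF) = ((ν₀ univ)⁻¹ * ν₁ univ).toReal)
    (hσ : 0 < ((∫ p, (Real.exp (-W p.2) - ∫ p', Real.exp (-W p'.2)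
            ∂(cpnGibbsLaw src tgt J c ⊗ₘ κF)) ^ 2 ∂(cpnGibbsLaw src tgt J c ⊗ₘ κF))
          + 2 * ∑' k, ∫ p, (Real.exp (-W p.2) - ∫ p', Real.exp (-W p'.2)
            ∂(cpnGibbsLaw src tgt J c ⊗ₘ κF))
            * (kop ((Kernel.prodMkRight P (cpnMetropolisSweep src tgt J c εs εl l))
                ⊗ₖ (Kernel.prodMkLeft (CPNConfig V E d × P) κF)))^[k + 1]
              (fun p => Real.exp (-W p.2) - ∫ p', Real.exp (-W p'.2)
                ∂(cpnGibbsLaw src tgt J c ⊗ₘ κF)) p ∂(cpnGibbsLaw src tgt J c ⊗ₘ κF)))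
    (μ₀ : Measure (CPNConfig V E d × P)) [IsProbabilityMeasure μ₀] {a b : ℕ → ℕ}
    (ha : Tendsto a atTop atTop) (hb : Tendsto b atTop atTop) {z : ℝ} (hz : 0 < z)
    [hK : IsMarkovKernel (cpnMetropolisSweep src tgt J c εs εl l)]
    [IsProbabilityMeasure (Kernel.trajMeasure (X := fun _ : ℕ => CPNConfig V E d × P) μ₀
          (fun n : ℕ => ((Kernel.prodMkRight P (cpnMetropolisSweep src tgt J c εs εl l))
              ⊗ₖ (Kernel.prodMkLeft (CPNConfig V E d × P) κF)).comap
            (fun h : (i : ↥(Finset.Iic n)) → CPNConfig V E d × P => h ⟨n, Finset.mem_Iic.2 le_rfl⟩)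
            (measurable_pi_apply _)))] :
    Tendsto (fun n : ℕ => (Kernel.trajMeasure (X := fun _ : ℕ => CPNConfig V E d × P) μ₀
          (fun n : ℕ => ((Kernel.prodMkRight P (cpnMetropolisSweep src tgt J c εs εl l))
              ⊗ₖ (Kernel.prodMkLeft (CPNConfig V E d × P) κF)).comap
            (fun h : (i : ↥(Finset.Iic n)) → CPNConfig V E d × P => h ⟨n, Finset.mem_Iic.2 le_rfl⟩)
            (measurable_pi_apply _))).real
      {x | |Real.sqrt ((b n * a n : ℕ) : ℝ)
          * (-Real.log ((∑ t ∈ Finset.range (b n * a n), Real.exp (-W (x t).2))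
            / ((b n * a n : ℕ) : ℝ)) - ΔF)
          / (|(-((∑ t ∈ Finset.range (b n * a n), Real.exp (-W (x t).2)) / ((b n * a n : ℕ) : ℝ))⁻¹)|
            * Real.sqrt (((b n * a n : ℕ) : ℝ) * replicaSEsq (fun j (x : ℕ → CPNConfig V E d × P) =>
              (∑ i ∈ Finset.range (b n), Real.exp (-W (x (b n * j + i)).2)) / (b n)) (a n) x))| ≤ z})
      atTop (𝓝 ((gaussianReal 0 1).real (Set.Icc (-z) z))) := by
  haveI := isProbabilityMeasure_cpnGibbsLaw src tgt J c (V := V) (E := E) (d := d)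
  obtain ⟨hinv, ε, hε0, -, hdoeb⟩ :=
    cpn_metropolisSweep_minorised_by_cpnGibbsLaw src tgt J c hεs hεl hl
  exact restart_jarzynski_deltaF_coverage (π₀ := cpnGibbsLaw src tgt J c)
    (κ₀ := cpnMetropolisSweep src tgt J c εs εl l) h hπ₀ hinv (fun x _ hB => hdoeb x hB) hε0 hlo
    hΔF hσ μ₀ ha hb hz

end CPN

end Summit.Ventures.LatticeQCDFlow.Scoring

end
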